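import Summits.KontsevichZagierPeriods.KontsevichZagierPeriods.Theses.TerasomaMultiplication
import Summits.KontsevichZagierPeriods.KontsevichZagierPeriods.Theorems.CompleteModGammaSector.Negative.LoadBearing
import Literature.NumberTheory.Transcendental.KZProductIdeal
import Literature.NumberTheory.Transcendental.KZCalculusProofs

/-!
# `CompleteModGammaSector` (stmt-KontsevichZagierPeriods-14233) — line
# `line-wolfart-collapses-to-huber-wustholz`: the RESIDUAL, kernel-checked bookkeeping

Sorry-free companion of the registered stub `stub_residualOffHypergeometric` of the line lead's
skeleton `Cruxes/CompleteModGammaSector/Lines/line_wolfart_collapses_to_huber_wustholz.lean`.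
The residual is Conjecture 1 modulo the Γ-sector AND the "Wolfart sector":

  `ker eval ≤ sector ⊔ closure W`,

where `sector = relations ⊔ closure gammaHodgePairs`
(`CompleteModGammaSectorNegative.sector`) and `W ⊆ FormalRep` is the set of Euler–Beta pair
differences `[r] − [ρ]` — `r = [(0,1), α t^{b−1}(1−t)^{c−b−1}(1−λt)^{−a}]` a hypergeometric Euler
integral at a real algebraic argument `λ ∈ (0,1)` with `a, b, c − a, c − b ∉ ℤ`, `ρ = [(0,1),
β t^{x−1}(1−t)^{y−1}]` an algebraic multiple of a Beta integral, of the same value — together with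
their left multiples `z * ([r] − [ρ])` in the ring `FormalRep` (the set is written out verbatim in
every statement below; no definition is introduced).

The residual itself is of the strength of the crux (it is NOT proved here). What this file proves:

* `residualOffHypergeometric_of_crux` — the crux implies the residual (`sector ≤ sector ⊔ _`), so
  with `CompleteModGammaSectorNegative.of_summit` the residual is summit-implied
  (`residualOffHypergeometric_of_summit`) and a refutation of it refutes Conjecture 1 as formalised
  (`summit_false_of_not_residualOffHypergeometric`);
* `wolfartPairs_le_ker_eval` — NO evaluation kill of the enlarged sector: `closure W ≤ ker eval`
  (a pair difference evaluates to `r.value − ρ.value = 0`; a left multiple to `eval z · 0 = 0` by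
  the proved multiplicativity of evaluation `KZ.eval_mul'`, Fubini, `KZProductIdeal.lean`), whence
  `sector ⊔ closure W ≤ ker eval` and the residual is EQUIVALENT to the kernel equality
  `ker eval = sector ⊔ closure W` (`residualOffHypergeometric_iff_ker_eq`);
* `completeModGammaSector_iff_residual_of_pairs` — once the Wolfart pairs are relations
  (`closure W ≤ relations`: the content of the line's two other stubs, Euler's transformation and
  the single-Beta transfer, taken here as a hypothesis), the crux is EQUIVALENT to the residual;
  `subset_relations_of_wolfart_equivalent` converts the pair-level form of that hypothesis
  (`… → r.value = ρ.value → Equivalent r ρ`) into `W ⊆ relations` (`relations` is a left ideal,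
  `KZ.mul_mem_relations_left_holds`).

References: Kontsevich–Zagier 2001 §1.2 (Conjecture 1), §4.1 (Fubini); Wolfart 1988;
Huber–Wüstholz 2022 Thm 13.3.
-/

noncomputable section

-- `Summit.KontsevichZagierPeriods.KontsevichZagierPeriods.…` is the tree's mandated layout (single-conjunct summit).
set_option linter.dupNamespace false

namespace Summit.KontsevichZagierPeriods.KontsevichZagierPeriods.CompleteModGammaSectorWolfartLine

open MeasureTheory Set
open Literature.NumberTheory.Transcendental
open Literature.NumberTheory.Transcendental.KZ
open Summit.KontsevichZagierPeriods.KontsevichZagierPeriods.Theses.TerasomaMultiplication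
  (CompleteModGammaSector)
open Summit.KontsevichZagierPeriods.CompleteModGammaSectorNegative
  (gammaHodgePairs sector completeModGammaSector_iff_ker_le sector_le_ker_eval of_summit)

/-! ## The residual is crux-implied (hence summit-implied: no kill short of `¬` summit) -/

/-- **The crux implies the residual**: `ker eval ≤ sector` (kernel form of the crux,
`completeModGammaSector_iff_ker_le`) and `sector ≤ sector ⊔ closure W`.
[cite: KontsevichZagier2001, §1.2 Conjecture 1] -/
theorem residualOffHypergeometric_of_crux (h : CompleteModGammaSector) :
    eval.ker ≤ sector ⊔ AddSubgroup.closure {d : FormalRep | ∃ (a b c x y : ℚ) (lam α β : ℝ)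
      (r ρ : IntegralRep 1),
      (Int.fract a ≠ 0 ∧ Int.fract b ≠ 0 ∧ Int.fract (c - a) ≠ 0 ∧ Int.fract (c - b) ≠ 0) ∧
      (0 < b ∧ b < c) ∧ (0 < x ∧ 0 < y ∧ Int.fract x ≠ 0 ∧ Int.fract y ≠ 0) ∧
      (0 < lam ∧ lam < 1 ∧ IsAlgebraic ℚ lam ∧ IsAlgebraic ℚ α ∧ IsAlgebraic ℚ β) ∧
      r.domain = {t | t 0 ∈ Set.Ioo (0:ℝ) 1} ∧
      Set.EqOn r.integrand (fun t => α * (t 0) ^ ((b : ℝ) - 1) * (1 - t 0) ^ ((c : ℝ) - (b : ℝ) - 1) *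
        (1 - lam * t 0) ^ (-(a : ℝ))) r.domain ∧
      ρ.domain = {t | t 0 ∈ Set.Ioo (0:ℝ) 1} ∧
      Set.EqOn ρ.integrand (fun t => β * (t 0) ^ ((x : ℝ) - 1) * (1 - t 0) ^ ((y : ℝ) - 1)) ρ.domain ∧
      r.value = ρ.value ∧ (d = of r - of ρ ∨ ∃ z : FormalRep, d = z * (of r - of ρ))} :=
  (completeModGammaSector_iff_ker_le.mp h).trans le_sup_left

/-- The residual is implied by the summit `KontsevichZagierPeriods` (Conjecture 1 as formalised),
via `CompleteModGammaSectorNegative.of_summit`. [cite: KontsevichZagier2001, §1.2 Conjecture 1] -/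
theorem residualOffHypergeometric_of_summit (h : KontsevichZagierPeriods) :
    eval.ker ≤ sector ⊔ AddSubgroup.closure {d : FormalRep | ∃ (a b c x y : ℚ) (lam α β : ℝ)
      (r ρ : IntegralRep 1),
      (Int.fract a ≠ 0 ∧ Int.fract b ≠ 0 ∧ Int.fract (c - a) ≠ 0 ∧ Int.fract (c - b) ≠ 0) ∧
      (0 < b ∧ b < c) ∧ (0 < x ∧ 0 < y ∧ Int.fract x ≠ 0 ∧ Int.fract y ≠ 0) ∧
      (0 < lam ∧ lam < 1 ∧ IsAlgebraic ℚ lam ∧ IsAlgebraic ℚ α ∧ IsAlgebraic ℚ β) ∧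
      r.domain = {t | t 0 ∈ Set.Ioo (0:ℝ) 1} ∧
      Set.EqOn r.integrand (fun t => α * (t 0) ^ ((b : ℝ) - 1) * (1 - t 0) ^ ((c : ℝ) - (b : ℝ) - 1) *
        (1 - lam * t 0) ^ (-(a : ℝ))) r.domain ∧
      ρ.domain = {t | t 0 ∈ Set.Ioo (0:ℝ) 1} ∧
      Set.EqOn ρ.integrand (fun t => β * (t 0) ^ ((x : ℝ) - 1) * (1 - t 0) ^ ((y : ℝ) - 1)) ρ.domain ∧
      r.value = ρ.value ∧ (d = of r - of ρ ∨ ∃ z : FormalRep, d = z * (of r - of ρ))} :=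
  residualOffHypergeometric_of_crux (of_summit h)

/-- Contrapositive: a refutation of the residual refutes the summit as formalised. [folklore] -/
theorem summit_false_of_not_residualOffHypergeometric
    (h : ¬ (eval.ker ≤ sector ⊔ AddSubgroup.closure {d : FormalRep | ∃ (a b c x y : ℚ) (lam α β : ℝ)
      (r ρ : IntegralRep 1),
      (Int.fract a ≠ 0 ∧ Int.fract b ≠ 0 ∧ Int.fract (c - a) ≠ 0 ∧ Int.fract (c - b) ≠ 0) ∧
      (0 < b ∧ b < c) ∧ (0 < x ∧ 0 < y ∧ Int.fract x ≠ 0 ∧ Int.fract y ≠ 0) ∧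
      (0 < lam ∧ lam < 1 ∧ IsAlgebraic ℚ lam ∧ IsAlgebraic ℚ α ∧ IsAlgebraic ℚ β) ∧
      r.domain = {t | t 0 ∈ Set.Ioo (0:ℝ) 1} ∧
      Set.EqOn r.integrand (fun t => α * (t 0) ^ ((b : ℝ) - 1) * (1 - t 0) ^ ((c : ℝ) - (b : ℝ) - 1) *
        (1 - lam * t 0) ^ (-(a : ℝ))) r.domain ∧
      ρ.domain = {t | t 0 ∈ Set.Ioo (0:ℝ) 1} ∧
      Set.EqOn ρ.integrand (fun t => β * (t 0) ^ ((x : ℝ) - 1) * (1 - t 0) ^ ((y : ℝ) - 1)) ρ.domain ∧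
      r.value = ρ.value ∧ (d = of r - of ρ ∨ ∃ z : FormalRep, d = z * (of r - of ρ))})) :
    ¬ KontsevichZagierPeriods :=
  fun hs => h (residualOffHypergeometric_of_summit hs)

/-! ## No evaluation kill: the Wolfart sector lies in `ker eval` -/

/-- **The Wolfart pairs evaluate to zero**: `closure W ≤ ker eval`. A pair difference
`[r] − [ρ]` has value `r.value − ρ.value = 0` (`KZ.eval_of_sub_of`); a left multiple
`z * ([r] − [ρ])` has value `eval z · 0 = 0` by the multiplicativity of evaluation on the ring
`FormalRep` (Fubini: `KZ.eval_mul'`, proved in `KZProductIdeal.lean`).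
[cite: KontsevichZagier2001, §4.1] -/
theorem wolfartPairs_le_ker_eval :
    AddSubgroup.closure {d : FormalRep | ∃ (a b c x y : ℚ) (lam α β : ℝ)
      (r ρ : IntegralRep 1),
      (Int.fract a ≠ 0 ∧ Int.fract b ≠ 0 ∧ Int.fract (c - a) ≠ 0 ∧ Int.fract (c - b) ≠ 0) ∧
      (0 < b ∧ b < c) ∧ (0 < x ∧ 0 < y ∧ Int.fract x ≠ 0 ∧ Int.fract y ≠ 0) ∧
      (0 < lam ∧ lam < 1 ∧ IsAlgebraic ℚ lam ∧ IsAlgebraic ℚ α ∧ IsAlgebraic ℚ β) ∧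
      r.domain = {t | t 0 ∈ Set.Ioo (0:ℝ) 1} ∧
      Set.EqOn r.integrand (fun t => α * (t 0) ^ ((b : ℝ) - 1) * (1 - t 0) ^ ((c : ℝ) - (b : ℝ) - 1) *
        (1 - lam * t 0) ^ (-(a : ℝ))) r.domain ∧
      ρ.domain = {t | t 0 ∈ Set.Ioo (0:ℝ) 1} ∧
      Set.EqOn ρ.integrand (fun t => β * (t 0) ^ ((x : ℝ) - 1) * (1 - t 0) ^ ((y : ℝ) - 1)) ρ.domain ∧
      r.value = ρ.value ∧ (d = of r - of ρ ∨ ∃ z : FormalRep, d = z * (of r - of ρ))} ≤ eval.ker := by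
  refine (AddSubgroup.closure_le _).mpr ?_
  rintro d ⟨a, b, c, x, y, lam, α, β, r, ρ, -, -, -, -, -, -, -, -, hv, hd⟩
  have h0 : eval (of r - of ρ) = 0 := by rw [eval_of_sub_of, hv, sub_self]
  rcases hd with rfl | ⟨z, rfl⟩
  · exact h0
  · show eval (z * (of r - of ρ)) = 0
    rw [eval_mul', h0, mul_zero]

/-- The enlarged sector evaluates to `0`: `sector ⊔ closure W ≤ ker eval`
(`CompleteModGammaSectorNegative.sector_le_ker_eval` and `wolfartPairs_le_ker_eval`). [folklore] -/
theorem sector_sup_wolfartPairs_le_ker_eval :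
    sector ⊔ AddSubgroup.closure {d : FormalRep | ∃ (a b c x y : ℚ) (lam α β : ℝ)
      (r ρ : IntegralRep 1),
      (Int.fract a ≠ 0 ∧ Int.fract b ≠ 0 ∧ Int.fract (c - a) ≠ 0 ∧ Int.fract (c - b) ≠ 0) ∧
      (0 < b ∧ b < c) ∧ (0 < x ∧ 0 < y ∧ Int.fract x ≠ 0 ∧ Int.fract y ≠ 0) ∧
      (0 < lam ∧ lam < 1 ∧ IsAlgebraic ℚ lam ∧ IsAlgebraic ℚ α ∧ IsAlgebraic ℚ β) ∧
      r.domain = {t | t 0 ∈ Set.Ioo (0:ℝ) 1} ∧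
      Set.EqOn r.integrand (fun t => α * (t 0) ^ ((b : ℝ) - 1) * (1 - t 0) ^ ((c : ℝ) - (b : ℝ) - 1) *
        (1 - lam * t 0) ^ (-(a : ℝ))) r.domain ∧
      ρ.domain = {t | t 0 ∈ Set.Ioo (0:ℝ) 1} ∧
      Set.EqOn ρ.integrand (fun t => β * (t 0) ^ ((x : ℝ) - 1) * (1 - t 0) ^ ((y : ℝ) - 1)) ρ.domain ∧
      r.value = ρ.value ∧ (d = of r - of ρ ∨ ∃ z : FormalRep, d = z * (of r - of ρ))} ≤ eval.ker :=
  sup_le sector_le_ker_eval wolfartPairs_le_ker_eval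

/-- **Kernel-equality form of the residual**: the residual holds iff
`ker eval = sector ⊔ closure W` (the reverse inclusion is `sector_sup_wolfartPairs_le_ker_eval`).
A refutation is therefore exactly an additive invariant of `FormalRep` killing the moves, the
Γ-Hodge pairs and the Wolfart pairs (with their left multiples) but not factoring through `eval`.
[cite: KontsevichZagier2001, §1.2 Conjecture 1] -/
theorem residualOffHypergeometric_iff_ker_eq :
    (eval.ker ≤ sector ⊔ AddSubgroup.closure {d : FormalRep | ∃ (a b c x y : ℚ) (lam α β : ℝ)
      (r ρ : IntegralRep 1),
      (Int.fract a ≠ 0 ∧ Int.fract b ≠ 0 ∧ Int.fract (c - a) ≠ 0 ∧ Int.fract (c - b) ≠ 0) ∧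
      (0 < b ∧ b < c) ∧ (0 < x ∧ 0 < y ∧ Int.fract x ≠ 0 ∧ Int.fract y ≠ 0) ∧
      (0 < lam ∧ lam < 1 ∧ IsAlgebraic ℚ lam ∧ IsAlgebraic ℚ α ∧ IsAlgebraic ℚ β) ∧
      r.domain = {t | t 0 ∈ Set.Ioo (0:ℝ) 1} ∧
      Set.EqOn r.integrand (fun t => α * (t 0) ^ ((b : ℝ) - 1) * (1 - t 0) ^ ((c : ℝ) - (b : ℝ) - 1) *
        (1 - lam * t 0) ^ (-(a : ℝ))) r.domain ∧
      ρ.domain = {t | t 0 ∈ Set.Ioo (0:ℝ) 1} ∧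
      Set.EqOn ρ.integrand (fun t => β * (t 0) ^ ((x : ℝ) - 1) * (1 - t 0) ^ ((y : ℝ) - 1)) ρ.domain ∧
      r.value = ρ.value ∧ (d = of r - of ρ ∨ ∃ z : FormalRep, d = z * (of r - of ρ))}) ↔
    eval.ker = sector ⊔ AddSubgroup.closure {d : FormalRep | ∃ (a b c x y : ℚ) (lam α β : ℝ)
      (r ρ : IntegralRep 1),
      (Int.fract a ≠ 0 ∧ Int.fract b ≠ 0 ∧ Int.fract (c - a) ≠ 0 ∧ Int.fract (c - b) ≠ 0) ∧
      (0 < b ∧ b < c) ∧ (0 < x ∧ 0 < y ∧ Int.fract x ≠ 0 ∧ Int.fract y ≠ 0) ∧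
      (0 < lam ∧ lam < 1 ∧ IsAlgebraic ℚ lam ∧ IsAlgebraic ℚ α ∧ IsAlgebraic ℚ β) ∧
      r.domain = {t | t 0 ∈ Set.Ioo (0:ℝ) 1} ∧
      Set.EqOn r.integrand (fun t => α * (t 0) ^ ((b : ℝ) - 1) * (1 - t 0) ^ ((c : ℝ) - (b : ℝ) - 1) *
        (1 - lam * t 0) ^ (-(a : ℝ))) r.domain ∧
      ρ.domain = {t | t 0 ∈ Set.Ioo (0:ℝ) 1} ∧
      Set.EqOn ρ.integrand (fun t => β * (t 0) ^ ((x : ℝ) - 1) * (1 - t 0) ^ ((y : ℝ) - 1)) ρ.domain ∧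
      r.value = ρ.value ∧ (d = of r - of ρ ∨ ∃ z : FormalRep, d = z * (of r - of ρ))} :=
  ⟨fun h => le_antisymm h sector_sup_wolfartPairs_le_ker_eval, fun h => h.le⟩

/-! ## Given the Wolfart pairs as relations, the crux IS the residual -/

/-- Pair-level form of the hypothesis of the reduction: if every Wolfart pair is a KZ-equivalence
(the content of the line's stubs `stub_eulerTransformationMove` + `stub_eulerBetaTransfer`,
taken here as a hypothesis), then the generating set `W` lies in `relations` — the pair
differences by definition of `Equivalent`, their left multiples because `relations` is a left
ideal of `FormalRep` (`KZ.mul_mem_relations_left_holds`). [cite: KontsevichZagier2001, §1.2] -/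
theorem subset_relations_of_wolfart_equivalent
    (H : ∀ (a b c x y : ℚ) (lam α β : ℝ), Int.fract a ≠ 0 → Int.fract b ≠ 0 →
      Int.fract (c - a) ≠ 0 → Int.fract (c - b) ≠ 0 → 0 < b → b < c → 0 < x → 0 < y →
      Int.fract x ≠ 0 → Int.fract y ≠ 0 → 0 < lam → lam < 1 → IsAlgebraic ℚ lam →
      IsAlgebraic ℚ α → IsAlgebraic ℚ β →
      ∀ (r ρ : IntegralRep 1), r.domain = {t | t 0 ∈ Set.Ioo (0:ℝ) 1} →
      Set.EqOn r.integrand (fun t => α * (t 0) ^ ((b : ℝ) - 1) * (1 - t 0) ^ ((c : ℝ) - (b : ℝ) - 1) *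
        (1 - lam * t 0) ^ (-(a : ℝ))) r.domain →
      ρ.domain = {t | t 0 ∈ Set.Ioo (0:ℝ) 1} →
      Set.EqOn ρ.integrand (fun t => β * (t 0) ^ ((x : ℝ) - 1) * (1 - t 0) ^ ((y : ℝ) - 1)) ρ.domain →
      r.value = ρ.value → Equivalent r ρ) :
    {d : FormalRep | ∃ (a b c x y : ℚ) (lam α β : ℝ) (r ρ : IntegralRep 1),
      (Int.fract a ≠ 0 ∧ Int.fract b ≠ 0 ∧ Int.fract (c - a) ≠ 0 ∧ Int.fract (c - b) ≠ 0) ∧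
      (0 < b ∧ b < c) ∧ (0 < x ∧ 0 < y ∧ Int.fract x ≠ 0 ∧ Int.fract y ≠ 0) ∧
      (0 < lam ∧ lam < 1 ∧ IsAlgebraic ℚ lam ∧ IsAlgebraic ℚ α ∧ IsAlgebraic ℚ β) ∧
      r.domain = {t | t 0 ∈ Set.Ioo (0:ℝ) 1} ∧
      Set.EqOn r.integrand (fun t => α * (t 0) ^ ((b : ℝ) - 1) * (1 - t 0) ^ ((c : ℝ) - (b : ℝ) - 1) *
        (1 - lam * t 0) ^ (-(a : ℝ))) r.domain ∧
      ρ.domain = {t | t 0 ∈ Set.Ioo (0:ℝ) 1} ∧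
      Set.EqOn ρ.integrand (fun t => β * (t 0) ^ ((x : ℝ) - 1) * (1 - t 0) ^ ((y : ℝ) - 1)) ρ.domain ∧
      r.value = ρ.value ∧ (d = of r - of ρ ∨ ∃ z : FormalRep, d = z * (of r - of ρ))} ⊆
      (relations : Set FormalRep) := by
  rintro d ⟨a, b, c, x, y, lam, α, β, r, ρ, ⟨ha, hb, hca, hcb⟩, ⟨hb0, hbc⟩, ⟨hx, hy, hxf, hyf⟩,
    ⟨hl0, hl1, hlam, hα, hβ⟩, hrd, hri, hρd, hρi, hv, hd⟩
  have hE : of r - of ρ ∈ relations :=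
    H a b c x y lam α β ha hb hca hcb hb0 hbc hx hy hxf hyf hl0 hl1 hlam hα hβ r ρ hrd hri hρd hρi hv
  rcases hd with rfl | ⟨z, rfl⟩
  · exact hE
  · exact mul_mem_relations_left_holds _ z hE

/-- **Backward direction of the reduction**: if the Wolfart sector lies in `relations` and the
residual holds, then the crux holds (`closure W ≤ relations ≤ sector`, so the residual's bound
collapses to `ker eval ≤ sector`, the kernel form of the crux).
[cite: KontsevichZagier2001, §1.2 Conjecture 1] -/
theorem completeModGammaSector_of_residual_of_pairs
    (hW : AddSubgroup.closure {d : FormalRep | ∃ (a b c x y : ℚ) (lam α β : ℝ)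
      (r ρ : IntegralRep 1),
      (Int.fract a ≠ 0 ∧ Int.fract b ≠ 0 ∧ Int.fract (c - a) ≠ 0 ∧ Int.fract (c - b) ≠ 0) ∧
      (0 < b ∧ b < c) ∧ (0 < x ∧ 0 < y ∧ Int.fract x ≠ 0 ∧ Int.fract y ≠ 0) ∧
      (0 < lam ∧ lam < 1 ∧ IsAlgebraic ℚ lam ∧ IsAlgebraic ℚ α ∧ IsAlgebraic ℚ β) ∧
      r.domain = {t | t 0 ∈ Set.Ioo (0:ℝ) 1} ∧
      Set.EqOn r.integrand (fun t => α * (t 0) ^ ((b : ℝ) - 1) * (1 - t 0) ^ ((c : ℝ) - (b : ℝ) - 1) *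
        (1 - lam * t 0) ^ (-(a : ℝ))) r.domain ∧
      ρ.domain = {t | t 0 ∈ Set.Ioo (0:ℝ) 1} ∧
      Set.EqOn ρ.integrand (fun t => β * (t 0) ^ ((x : ℝ) - 1) * (1 - t 0) ^ ((y : ℝ) - 1)) ρ.domain ∧
      r.value = ρ.value ∧ (d = of r - of ρ ∨ ∃ z : FormalRep, d = z * (of r - of ρ))} ≤ relations)
    (hR : eval.ker ≤ sector ⊔ AddSubgroup.closure {d : FormalRep | ∃ (a b c x y : ℚ) (lam α β : ℝ)
      (r ρ : IntegralRep 1),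
      (Int.fract a ≠ 0 ∧ Int.fract b ≠ 0 ∧ Int.fract (c - a) ≠ 0 ∧ Int.fract (c - b) ≠ 0) ∧
      (0 < b ∧ b < c) ∧ (0 < x ∧ 0 < y ∧ Int.fract x ≠ 0 ∧ Int.fract y ≠ 0) ∧
      (0 < lam ∧ lam < 1 ∧ IsAlgebraic ℚ lam ∧ IsAlgebraic ℚ α ∧ IsAlgebraic ℚ β) ∧
      r.domain = {t | t 0 ∈ Set.Ioo (0:ℝ) 1} ∧
      Set.EqOn r.integrand (fun t => α * (t 0) ^ ((b : ℝ) - 1) * (1 - t 0) ^ ((c : ℝ) - (b : ℝ) - 1) *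
        (1 - lam * t 0) ^ (-(a : ℝ))) r.domain ∧
      ρ.domain = {t | t 0 ∈ Set.Ioo (0:ℝ) 1} ∧
      Set.EqOn ρ.integrand (fun t => β * (t 0) ^ ((x : ℝ) - 1) * (1 - t 0) ^ ((y : ℝ) - 1)) ρ.domain ∧
      r.value = ρ.value ∧ (d = of r - of ρ ∨ ∃ z : FormalRep, d = z * (of r - of ρ))}) :
    CompleteModGammaSector :=
  completeModGammaSector_iff_ker_le.mpr (hR.trans (sup_le le_rfl (hW.trans le_sup_left)))

/-- **The line's reduction, kernel-checked**: given the Wolfart pairs as relations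
(`closure W ≤ relations`, the content of the two other registered stubs of the line), the crux
`CompleteModGammaSector` is EQUIVALENT to the residual `ker eval ≤ sector ⊔ closure W`.
[cite: KontsevichZagier2001, §1.2 Conjecture 1] -/
theorem completeModGammaSector_iff_residual_of_pairs :
    AddSubgroup.closure {d : FormalRep | ∃ (a b c x y : ℚ) (lam α β : ℝ) (r ρ : IntegralRep 1),
      (Int.fract a ≠ 0 ∧ Int.fract b ≠ 0 ∧ Int.fract (c - a) ≠ 0 ∧ Int.fract (c - b) ≠ 0) ∧
      (0 < b ∧ b < c) ∧ (0 < x ∧ 0 < y ∧ Int.fract x ≠ 0 ∧ Int.fract y ≠ 0) ∧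
      (0 < lam ∧ lam < 1 ∧ IsAlgebraic ℚ lam ∧ IsAlgebraic ℚ α ∧ IsAlgebraic ℚ β) ∧
      r.domain = {t | t 0 ∈ Set.Ioo (0:ℝ) 1} ∧
      Set.EqOn r.integrand (fun t => α * (t 0) ^ ((b : ℝ) - 1) * (1 - t 0) ^ ((c : ℝ) - (b : ℝ) - 1) *
        (1 - lam * t 0) ^ (-(a : ℝ))) r.domain ∧
      ρ.domain = {t | t 0 ∈ Set.Ioo (0:ℝ) 1} ∧
      Set.EqOn ρ.integrand (fun t => β * (t 0) ^ ((x : ℝ) - 1) * (1 - t 0) ^ ((y : ℝ) - 1)) ρ.domain ∧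
      r.value = ρ.value ∧ (d = of r - of ρ ∨ ∃ z : FormalRep, d = z * (of r - of ρ))} ≤ relations →
    (CompleteModGammaSector ↔
      eval.ker ≤ sector ⊔ AddSubgroup.closure {d : FormalRep | ∃ (a b c x y : ℚ) (lam α β : ℝ)
        (r ρ : IntegralRep 1),
        (Int.fract a ≠ 0 ∧ Int.fract b ≠ 0 ∧ Int.fract (c - a) ≠ 0 ∧ Int.fract (c - b) ≠ 0) ∧
        (0 < b ∧ b < c) ∧ (0 < x ∧ 0 < y ∧ Int.fract x ≠ 0 ∧ Int.fract y ≠ 0) ∧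
        (0 < lam ∧ lam < 1 ∧ IsAlgebraic ℚ lam ∧ IsAlgebraic ℚ α ∧ IsAlgebraic ℚ β) ∧
        r.domain = {t | t 0 ∈ Set.Ioo (0:ℝ) 1} ∧
        Set.EqOn r.integrand (fun t => α * (t 0) ^ ((b : ℝ) - 1) * (1 - t 0) ^ ((c : ℝ) - (b : ℝ) - 1) *
          (1 - lam * t 0) ^ (-(a : ℝ))) r.domain ∧
        ρ.domain = {t | t 0 ∈ Set.Ioo (0:ℝ) 1} ∧
        Set.EqOn ρ.integrand (fun t => β * (t 0) ^ ((x : ℝ) - 1) * (1 - t 0) ^ ((y : ℝ) - 1)) ρ.domain ∧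
        r.value = ρ.value ∧ (d = of r - of ρ ∨ ∃ z : FormalRep, d = z * (of r - of ρ))}) :=
  fun hW => ⟨residualOffHypergeometric_of_crux, completeModGammaSector_of_residual_of_pairs hW⟩

/-- The same reduction with the pair-level hypothesis (every Wolfart pair is a KZ-equivalence).
[cite: KontsevichZagier2001, §1.2 Conjecture 1] -/
theorem completeModGammaSector_iff_residual_of_wolfart_equivalent
    (H : ∀ (a b c x y : ℚ) (lam α β : ℝ), Int.fract a ≠ 0 → Int.fract b ≠ 0 →
      Int.fract (c - a) ≠ 0 → Int.fract (c - b) ≠ 0 → 0 < b → b < c → 0 < x → 0 < y →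
      Int.fract x ≠ 0 → Int.fract y ≠ 0 → 0 < lam → lam < 1 → IsAlgebraic ℚ lam →
      IsAlgebraic ℚ α → IsAlgebraic ℚ β →
      ∀ (r ρ : IntegralRep 1), r.domain = {t | t 0 ∈ Set.Ioo (0:ℝ) 1} →
      Set.EqOn r.integrand (fun t => α * (t 0) ^ ((b : ℝ) - 1) * (1 - t 0) ^ ((c : ℝ) - (b : ℝ) - 1) *
        (1 - lam * t 0) ^ (-(a : ℝ))) r.domain →
      ρ.domain = {t | t 0 ∈ Set.Ioo (0:ℝ) 1} →
      Set.EqOn ρ.integrand (fun t => β * (t 0) ^ ((x : ℝ) - 1) * (1 - t 0) ^ ((y : ℝ) - 1)) ρ.domain →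
      r.value = ρ.value → Equivalent r ρ) :
    CompleteModGammaSector ↔
    eval.ker ≤ sector ⊔ AddSubgroup.closure {d : FormalRep | ∃ (a b c x y : ℚ) (lam α β : ℝ)
      (r ρ : IntegralRep 1),
      (Int.fract a ≠ 0 ∧ Int.fract b ≠ 0 ∧ Int.fract (c - a) ≠ 0 ∧ Int.fract (c - b) ≠ 0) ∧
      (0 < b ∧ b < c) ∧ (0 < x ∧ 0 < y ∧ Int.fract x ≠ 0 ∧ Int.fract y ≠ 0) ∧
      (0 < lam ∧ lam < 1 ∧ IsAlgebraic ℚ lam ∧ IsAlgebraic ℚ α ∧ IsAlgebraic ℚ β) ∧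
      r.domain = {t | t 0 ∈ Set.Ioo (0:ℝ) 1} ∧
      Set.EqOn r.integrand (fun t => α * (t 0) ^ ((b : ℝ) - 1) * (1 - t 0) ^ ((c : ℝ) - (b : ℝ) - 1) *
        (1 - lam * t 0) ^ (-(a : ℝ))) r.domain ∧
      ρ.domain = {t | t 0 ∈ Set.Ioo (0:ℝ) 1} ∧
      Set.EqOn ρ.integrand (fun t => β * (t 0) ^ ((x : ℝ) - 1) * (1 - t 0) ^ ((y : ℝ) - 1)) ρ.domain ∧
      r.value = ρ.value ∧ (d = of r - of ρ ∨ ∃ z : FormalRep, d = z * (of r - of ρ))} :=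
  completeModGammaSector_iff_residual_of_pairs
    ((AddSubgroup.closure_le _).mpr (subset_relations_of_wolfart_equivalent H))

end Summit.KontsevichZagierPeriods.KontsevichZagierPeriods.CompleteModGammaSectorWolfartLine
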